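import Literature.NumberTheory.LFunctions.BettinConreyFarmer2013Zeros
import Literature.NumberTheory.LFunctions.NymanBeurlingLindelofProofs
import Literature.Analysis.SpecialFunctions.GammaVerticalBounds
import Mathlib.Analysis.Complex.Liouville
import Mathlib.Analysis.Calculus.Deriv.Shift
import HarnessLib

/-!
# Bettin–Conrey–Farmer 2013, Theorem 1 — `ζ` in the strip under RH, and `ζ'/ζ(1−s)ζ(s)` at a zero

Topic `Literature/NumberTheory/LFunctions`; fifth "Proofs" companion of
`BettinConreyFarmer2013.lean`. Everything here is PROVED. Two inputs of the residue computation in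
the proof of Theorem 1 ([BettinConreyFarmer2013, §3, last display]: "the integrand has a double
pole at every zero `ρ` of residue `log N/|ρ|² + O(1/(|ρ|^{2−ε}|ζ'(ρ)|) + 1/|ρ|²)`, where we used the
bound `ζ''(1/2+it) ≪ |t|^ε`, which follows from the Lindelöf hypothesis and Cauchy's estimate"):

* `BCF.exists_norm_zeta_le_strip` — under RH, for `0 < η ≤ 1/4`: `‖ζ(u)‖ ≤ C (2 + |Im u|)^{2η}` on
  the closed strip `|Re u − 1/2| ≤ η` (Littlewood/Lindelöf on `Re u ≥ 1/2`, the tree's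
  `Literature.NumberTheory.LFunctions.norm_riemannZeta_le_mul_rpow_of_riemannHypothesis`, and the
  functional equation with `‖2(2π)^{-s}Γ(s)cos(πs/2)‖ ≤ 8π²(1+|t|)^{σ−1/2}` on the left half);
* `BCF.exists_localFactor` — at a simple non-trivial zero `ρ₀` (under RH, all zeros simple) the
  function `s ↦ ζ'/ζ(1−s)·ζ(s)` extends holomorphically to a neighbourhood of `ρ₀`, with value
  `−ζ'(ρ₀)` and derivative bounded by `3M/r²`, `M` a bound for `|ζ|` on the discs of radius `2r`
  about `ρ₀` and `1 − ρ₀` (through `ζ(s) = (s−ρ₀)·dslope ζ ρ₀ s`, the same for `ζ(1−s)`, and Cauchy's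
  estimate `‖f'(c)‖ ≤ sup_{|z−c|=r} ‖f‖/r`).

## References

* S. Bettin, J. B. Conrey, D. W. Farmer, Proc. Steklov Inst. Math. 280 (2013), suppl. 2
  (arXiv:1211.5191), §3, proof of Theorem 1. [BettinConreyFarmer2013]
* E. C. Titchmarsh, *The Theory of the Riemann Zeta-Function*, 2nd ed. (1986), §14.2.
-/

noncomputable section

open Complex Filter Set Real Metric
open scoped Topology ComplexConjugate

namespace Literature.NumberTheory.LFunctions

namespace BCF

/-! ## `ζ` in the strip `|Re u − 1/2| ≤ η` under RH -/

/-- **Lindelöf in the strip, under RH.** For `0 < η ≤ 1/4` there is `C > 0` with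
`‖ζ(u)‖ ≤ C (2 + |Im u|)^{2η}` whenever `|Re u − 1/2| ≤ η`. [cite: Titchmarsh1986, §14.2 (14.2.5)] -/
theorem exists_norm_zeta_le_strip (hRH : RiemannHypothesis) {η : ℝ} (hη0 : 0 < η) (hη : η ≤ 1 / 4) :
    ∃ C : ℝ, 0 < C ∧ ∀ u : ℂ, 1 / 2 - η ≤ u.re → u.re ≤ 1 / 2 + η →
      ‖riemannZeta u‖ ≤ C * (2 + |u.im|) ^ (2 * η) := by
  have hπ := Real.pi_gt_three
  obtain ⟨C₁, hC₁0, T₀, hT₀1, hL⟩ := norm_riemannZeta_le_mul_rpow_of_riemannHypothesis hRH hη0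
  -- right half `Re u ≥ 1/2`, `|Im u| ≥ T₀`
  have hright : ∀ u : ℂ, 1 / 2 ≤ u.re → T₀ ≤ |u.im| → ‖riemannZeta u‖ ≤ C₁ * (2 + |u.im|) ^ η := by
    intro u hu ht
    have key : ∀ v : ℂ, 1 / 2 ≤ v.re → T₀ ≤ v.im → ‖riemannZeta v‖ ≤ C₁ * (2 + |v.im|) ^ η := by
      intro v hv hvt
      have hv0 : 0 < v.im := by linarith
      refine (hL v hv hvt).trans (mul_le_mul_of_nonneg_left ?_ hC₁0.le)
      exact Real.rpow_le_rpow hv0.le (by rw [abs_of_pos hv0]; linarith) hη0.le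
    rcases le_or_gt 0 u.im with h0 | h0
    · rw [abs_of_nonneg h0] at ht; exact key u hu ht
    · have h1 := key (conj u) (by simpa using hu) (by rw [conj_im]; rw [abs_of_neg h0] at ht; exact ht)
      rw [riemannZeta_conj, Complex.norm_conj, conj_im, abs_neg] at h1
      exact h1
  -- the whole strip for `|Im u| ≥ T₀`
  have hbig : ∀ u : ℂ, 1 / 2 - η ≤ u.re → u.re ≤ 1 / 2 + η → T₀ ≤ |u.im| →
      ‖riemannZeta u‖ ≤ (8 * π ^ 2 * C₁) * (2 + |u.im|) ^ (2 * η) := by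
    intro u h1 h2 ht
    have h2η : (2 + |u.im|) ^ η ≤ (2 + |u.im|) ^ (2 * η) :=
      Real.rpow_le_rpow_of_exponent_le (by linarith [abs_nonneg u.im]) (by linarith)
    have hpow1 : 1 ≤ (2 + |u.im|) ^ η := Real.one_le_rpow (by linarith [abs_nonneg u.im]) hη0.le
    rcases le_or_gt (1 / 2) u.re with hu | hu
    · calc ‖riemannZeta u‖ ≤ C₁ * (2 + |u.im|) ^ η := hright u hu ht
        _ ≤ (8 * π ^ 2 * C₁) * (2 + |u.im|) ^ (2 * η) := by
            have h9 : (1 : ℝ) ≤ 8 * π ^ 2 := by nlinarith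
            have : C₁ ≤ 8 * π ^ 2 * C₁ := by nlinarith
            exact mul_le_mul this h2η (by positivity) (by positivity)
    · -- functional equation with `s = 1 - u`
      set s : ℂ := 1 - u with hs
      have hsre : s.re = 1 - u.re := by simp [hs]
      have hsim : s.im = -u.im := by simp [hs]
      have hT0 : u.im ≠ 0 := fun h ↦ by rw [h, abs_zero] at ht; linarith
      have hsn : ∀ n : ℕ, s ≠ -n := by
        intro n h; have := congrArg Complex.im h; simp [hsim] at this; exact hT0 this
      have hs1 : s ≠ 1 := by
        intro h; have := congrArg Complex.im h; simp [hsim] at this; exact hT0 this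
      have hfe := riemannZeta_one_sub hsn hs1
      have e : 1 - s = u := by rw [hs]; ring
      rw [e] at hfe
      have hfac := Literature.Analysis.SpecialFunctions.GammaVert.norm_fe_factor_le (s := s)
        (by rw [hsre]; linarith) (by rw [hsre]; linarith)
      have hζs : ‖riemannZeta s‖ ≤ C₁ * (2 + |u.im|) ^ η := by
        have := hright s (by rw [hsre]; linarith) (by rw [hsim, abs_neg]; exact ht)
        rwa [hsim, abs_neg] at this
      rw [hsim, abs_neg, hsre] at hfac
      have hexp : (1 + |u.im|) ^ (1 - u.re - 1 / 2) ≤ (2 + |u.im|) ^ η :=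
        (Real.rpow_le_rpow (by positivity) (by linarith) (by linarith)).trans
          (Real.rpow_le_rpow_of_exponent_le (by linarith [abs_nonneg u.im]) (by linarith))
      rw [hfe, norm_mul]
      calc ‖2 * (2 * (π : ℂ)) ^ (-s) * Complex.Gamma s * Complex.cos (π * s / 2)‖ * ‖riemannZeta s‖
          ≤ (8 * π ^ 2 * (2 + |u.im|) ^ η) * (C₁ * (2 + |u.im|) ^ η) :=
            mul_le_mul (hfac.trans (by gcongr)) hζs (norm_nonneg _) (by positivity)
        _ = (8 * π ^ 2 * C₁) * ((2 + |u.im|) ^ η * (2 + |u.im|) ^ η) := by ring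
        _ = (8 * π ^ 2 * C₁) * (2 + |u.im|) ^ (2 * η) := by
            rw [← Real.rpow_add (by linarith [abs_nonneg u.im])]; ring_nf
  -- the compact part `|Im u| ≤ T₀`
  set K : Set ℂ := (Icc (1 / 2 - η) (1 / 2 + η)) ×ℂ (Icc (-T₀) T₀) with hK
  have hKc : IsCompact K := isCompact_Icc.reProdIm isCompact_Icc
  have hcont : ContinuousOn riemannZeta K := by
    refine fun z hz ↦ (differentiableAt_riemannZeta ?_).continuousAt.continuousWithinAt
    intro h
    rw [hK, Complex.mem_reProdIm, h] at hz
    simp at hz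
    linarith [hz.1.2]
  obtain ⟨B, hB⟩ := hKc.exists_bound_of_continuousOn hcont
  have hB0 : 0 ≤ B := (norm_nonneg _).trans (hB (1 / 2 : ℂ) (by
    rw [hK, Complex.mem_reProdIm]
    simp only [mem_Icc]
    norm_num
    exact ⟨hη0.le, by linarith⟩))
  refine ⟨8 * π ^ 2 * C₁ + B + 1, by positivity, fun u h1 h2 ↦ ?_⟩
  have hpow : 1 ≤ (2 + |u.im|) ^ (2 * η) := Real.one_le_rpow (by linarith [abs_nonneg u.im]) (by linarith)
  rcases le_or_gt T₀ |u.im| with ht | ht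
  · calc ‖riemannZeta u‖ ≤ (8 * π ^ 2 * C₁) * (2 + |u.im|) ^ (2 * η) := hbig u h1 h2 ht
      _ ≤ (8 * π ^ 2 * C₁ + B + 1) * (2 + |u.im|) ^ (2 * η) := by gcongr; linarith
  · have hmem : u ∈ K := by
      rw [hK, Complex.mem_reProdIm]
      exact ⟨⟨h1, h2⟩, abs_le.1 ht.le⟩
    calc ‖riemannZeta u‖ ≤ B := hB u hmem
      _ ≤ (8 * π ^ 2 * C₁ + B + 1) * 1 := by nlinarith
      _ ≤ (8 * π ^ 2 * C₁ + B + 1) * (2 + |u.im|) ^ (2 * η) := by gcongr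

/-! ## Cauchy estimates -/

/-- Cauchy's estimate for the derivative of a `dslope`: if `f` is differentiable on an open set
containing the closed disc `|z − c| ≤ r` and `‖f‖ ≤ M` on the circle `|z − c| = r`, then
`‖(dslope f c)'(c)‖ ≤ M/r²` (on the circle `dslope f c = (f − f(c))/(z−c)` has norm `≤ 2M/r`… we
assume `f c = 0`, so `≤ M/r`). [folklore] -/
theorem norm_deriv_dslope_le {f : ℂ → ℂ} {c : ℂ} {r M : ℝ} (hr : 0 < r) {U : Set ℂ} (hU : IsOpen U)
    (hcU : closedBall c r ⊆ U) (hf : DifferentiableOn ℂ f U) (hfc : f c = 0)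
    (hM : ∀ z ∈ sphere c r, ‖f z‖ ≤ M) : ‖deriv (dslope f c) c‖ ≤ M / r / r := by
  have hq : DifferentiableOn ℂ (dslope f c) U :=
    (differentiableOn_dslope (hU.mem_nhds (hcU (mem_closedBall_self hr.le)))).2 hf
  refine Complex.norm_deriv_le_of_forall_mem_sphere_norm_le hr (hq.diffContOnCl_ball hcU) ?_
  intro z hz
  have hzc : z ≠ c := by
    intro h; rw [h, mem_sphere, dist_self] at hz; exact hr.ne' hz.symm
  have hnorm : ‖z - c‖ = r := by rwa [mem_sphere, dist_eq_norm] at hz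
  rw [dslope_of_ne _ hzc, slope_def_field, hfc, sub_zero, norm_div, hnorm]
  exact div_le_div_of_nonneg_right (hM z hz) hr.le

/-- Cauchy's estimate for the second derivative: if `f` is differentiable on an open set containing
the closed disc `|z − c| ≤ 2r` and `‖f‖ ≤ M` there, then `‖f''(c)‖ ≤ M/r²`. [folklore] -/
theorem norm_deriv_deriv_le {f : ℂ → ℂ} {c : ℂ} {r M : ℝ} (hr : 0 < r) {U : Set ℂ} (hU : IsOpen U)
    (hcU : closedBall c (2 * r) ⊆ U) (hf : DifferentiableOn ℂ f U)
    (hM : ∀ z ∈ closedBall c (2 * r), ‖f z‖ ≤ M) : ‖deriv (deriv f) c‖ ≤ M / r / r := by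
  have hf' : DifferentiableOn ℂ (deriv f) U := (hf.analyticOnNhd hU).deriv.differentiableOn
  have hsub : closedBall c r ⊆ U := (closedBall_subset_closedBall (by linarith)).trans hcU
  refine Complex.norm_deriv_le_of_forall_mem_sphere_norm_le hr (hf'.diffContOnCl_ball hsub) ?_
  intro z hz
  have hzr : ‖z - c‖ = r := by rwa [mem_sphere, dist_eq_norm] at hz
  -- Cauchy estimate for `f` on the disc of radius `r` about `z`
  have hzsub : closedBall z r ⊆ U := by
    refine Subset.trans ?_ hcU
    intro w hw
    rw [mem_closedBall, dist_eq_norm] at hw ⊢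
    calc ‖w - c‖ = ‖(w - z) + (z - c)‖ := by ring_nf
      _ ≤ ‖w - z‖ + ‖z - c‖ := norm_add_le _ _
      _ ≤ 2 * r := by linarith
  refine Complex.norm_deriv_le_of_forall_mem_sphere_norm_le hr (hf.diffContOnCl_ball hzsub) ?_
  intro w hw
  refine hM w ?_
  rw [mem_sphere, dist_eq_norm] at hw
  rw [mem_closedBall, dist_eq_norm]
  calc ‖w - c‖ = ‖(w - z) + (z - c)‖ := by ring_nf
    _ ≤ ‖w - z‖ + ‖z - c‖ := norm_add_le _ _
    _ ≤ 2 * r := by linarith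

/-! ## The local factor `ζ'/ζ(1−s)·ζ(s)` at a zero -/

/-- Under RH, `1 − ρ = conj ρ` for a non-trivial zero. [folklore] -/
theorem one_sub_eq_conj (hRH : RiemannHypothesis) {ρ : ℂ} (hρ : ρ ∈ ZetaZeros.riemannZetaNontrivialZeros) :
    1 - ρ = conj ρ := by
  apply Complex.ext
  · simp [ntz_re hRH hρ]; norm_num
  · simp

/-- **The local factor at a simple zero.** Assume RH and that all non-trivial zeros are simple. Let
`ρ₀` be a non-trivial zero, `0 < r ≤ 1/8`, and `M` a bound for `|ζ|` on the closed discs of radius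
`2r` about `ρ₀` and `1 − ρ₀`. Then there are an open neighbourhood `V` of `ρ₀` and `P` holomorphic
on `V` with `P(ρ₀) = −ζ'(ρ₀)`, `‖P'(ρ₀)‖ ≤ 3M/r²`, and `P(s) = ζ'(1−s)/ζ(1−s)·ζ(s)` (both `ζ`-values
non-zero) for `s ∈ V ∖ {ρ₀}`. (`P = ζ'(1−s)·q(s)/Q(s)` with `ζ(s) = (s−ρ₀)q(s)`,
`ζ(1−s) = (s−ρ₀)Q(s)`; the derivative bound is Cauchy's estimate for `q`, `Q` and `ζ''(1−ρ₀)`.)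
[cite: BettinConreyFarmer2013, §3, proof of Thm. 1 (residue computation)] -/
theorem exists_localFactor (hRH : RiemannHypothesis)
    (hsimp : ∀ ρ : ℂ, riemannZeta ρ = 0 → 0 < ρ.re → ρ.re < 1 → deriv riemannZeta ρ ≠ 0)
    {r : ℝ} (hr : 0 < r) (hr8 : r ≤ 1 / 8) {ρ₀ : ℂ} (hρ₀ : ρ₀ ∈ ZetaZeros.riemannZetaNontrivialZeros)
    {M : ℝ} (hM : ∀ z : ℂ, (‖z - ρ₀‖ ≤ 2 * r ∨ ‖z - (1 - ρ₀)‖ ≤ 2 * r) → ‖riemannZeta z‖ ≤ M) :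
    ∃ P : ℂ → ℂ, ∃ V : Set ℂ, IsOpen V ∧ ρ₀ ∈ V ∧ V ⊆ ball ρ₀ r ∧ DifferentiableOn ℂ P V ∧
      P ρ₀ = -deriv riemannZeta ρ₀ ∧ ‖deriv P ρ₀‖ ≤ 3 * (M / r / r) ∧
      ∀ s ∈ V, s ≠ ρ₀ → riemannZeta (1 - s) ≠ 0 ∧ riemannZeta s ≠ 0 ∧
        P s = deriv riemannZeta (1 - s) / riemannZeta (1 - s) * riemannZeta s := by
  obtain ⟨h0, -, -⟩ := ZetaZeros.riemannZetaNontrivialZeros.mem_iff'.1 hρ₀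
  have hre : ρ₀.re = 1 / 2 := ntz_re hRH hρ₀
  have hρ₀1 : ρ₀ ≠ 1 := ne_one_of_riemannZeta_eq_zero h0
  have hρ₀0 : ρ₀ ≠ 0 := fun h ↦ by rw [h, zero_re] at hre; norm_num at hre
  have hconj : 1 - ρ₀ = conj ρ₀ := one_sub_eq_conj hRH hρ₀
  have hρ₀' : (1 - ρ₀) ∈ ZetaZeros.riemannZetaNontrivialZeros := by
    rw [hconj]; exact ZetaZeros.riemannZetaNontrivialZeros.conj_mem hρ₀
  have h0' : riemannZeta (1 - ρ₀) = 0 :=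
    (ZetaZeros.riemannZetaNontrivialZeros.mem_iff'.1 hρ₀').1
  have hd0 : deriv riemannZeta ρ₀ ≠ 0 := ntz_deriv_ne_zero hsimp hρ₀
  have hd0' : deriv riemannZeta (1 - ρ₀) ≠ 0 := ntz_deriv_ne_zero hsimp hρ₀'
  have hnorm' : ‖deriv riemannZeta (1 - ρ₀)‖ = ‖deriv riemannZeta ρ₀‖ := by
    rw [hconj, norm_deriv_conj]
  -- `q = dslope ζ ρ₀`
  set q := dslope riemannZeta ρ₀ with hq
  have hqρ : q ρ₀ = deriv riemannZeta ρ₀ := by rw [hq, dslope_same]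
  have hU1 : IsOpen {z : ℂ | z ≠ 1} := isOpen_ne
  have hζd : DifferentiableOn ℂ riemannZeta {z : ℂ | z ≠ 1} := fun z hz ↦
    (differentiableAt_riemannZeta hz).differentiableWithinAt
  have hqd : DifferentiableOn ℂ q {z : ℂ | z ≠ 1} :=
    (differentiableOn_dslope (hU1.mem_nhds hρ₀1)).2 hζd
  have hfacq : ∀ z, riemannZeta z = (z - ρ₀) * q z := fun z ↦ by
    have h := sub_smul_dslope riemannZeta ρ₀ z
    rw [h0, sub_zero, smul_eq_mul] at h
    exact h.symm
  -- `g(s) = ζ(1 - s)`, `Q = dslope g ρ₀`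
  set g : ℂ → ℂ := fun s ↦ riemannZeta (1 - s) with hg
  have hU0 : IsOpen {z : ℂ | z ≠ 0} := isOpen_ne
  have hgd : DifferentiableOn ℂ g {z : ℂ | z ≠ 0} := by
    intro z hz
    have h1 : (1 - z) ≠ 1 := fun h ↦ hz (by linear_combination -h)
    exact ((differentiableAt_riemannZeta h1).comp z
      ((differentiableAt_const _).sub differentiableAt_id)).differentiableWithinAt
  have hgρ : g ρ₀ = 0 := h0'
  have hgderiv : HasDerivAt g (-deriv riemannZeta (1 - ρ₀)) ρ₀ := by
    have h1 : (1 - ρ₀) ≠ 1 := fun h ↦ hρ₀0 (by linear_combination -h)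
    exact (differentiableAt_riemannZeta h1).hasDerivAt.comp_const_sub 1 ρ₀
  set Q := dslope g ρ₀ with hQ
  have hQρ : Q ρ₀ = -deriv riemannZeta (1 - ρ₀) := by
    rw [hQ, dslope_same, hgderiv.deriv]
  have hQρ0 : Q ρ₀ ≠ 0 := by rw [hQρ]; exact neg_ne_zero.2 hd0'
  have hQd : DifferentiableOn ℂ Q {z : ℂ | z ≠ 0} :=
    (differentiableOn_dslope (hU0.mem_nhds hρ₀0)).2 hgd
  have hfacQ : ∀ z, riemannZeta (1 - z) = (z - ρ₀) * Q z := fun z ↦ by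
    have h := sub_smul_dslope g ρ₀ z
    rw [hgρ, sub_zero, smul_eq_mul] at h
    exact h.symm
  -- the neighbourhood
  have hQcont : ContinuousOn Q {z : ℂ | z ≠ 0} := hQd.continuousOn
  set V : Set ℂ := (({z : ℂ | z ≠ 0} ∩ Q ⁻¹' {w | w ≠ 0}) ∩ {z | z ≠ 1}) ∩ ball ρ₀ r with hV
  have hVo : IsOpen V :=
    (((hQcont.isOpen_inter_preimage hU0 isOpen_ne).inter isOpen_ne).inter isOpen_ball)
  have hρ₀V : ρ₀ ∈ V := ⟨⟨⟨hρ₀0, hQρ0⟩, hρ₀1⟩, mem_ball_self hr⟩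
  -- the function
  set P : ℂ → ℂ := fun s ↦ deriv riemannZeta (1 - s) * q s / Q s with hP
  have hAd : ∀ s : ℂ, s ≠ 0 → DifferentiableAt ℂ (fun s ↦ deriv riemannZeta (1 - s)) s := by
    intro s hs
    have h1 : (1 - s) ≠ 1 := fun h ↦ hs (by linear_combination -h)
    exact (analyticOn_riemannZeta (1 - s) h1).deriv.differentiableAt.comp s
      ((differentiableAt_const _).sub differentiableAt_id)
  have hPd : DifferentiableOn ℂ P V := by
    intro s hs
    obtain ⟨⟨⟨hs0, hQs⟩, hs1⟩, -⟩ := hs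
    refine DifferentiableAt.differentiableWithinAt ?_
    have h1 := hAd s hs0
    have h2 : DifferentiableAt ℂ q s := hqd.differentiableAt (hU1.mem_nhds hs1)
    have h3 : DifferentiableAt ℂ Q s := hQd.differentiableAt (hU0.mem_nhds hs0)
    exact (h1.mul h2).div h3 hQs
  refine ⟨P, V, hVo, hρ₀V, fun s hs ↦ hs.2, hPd, ?_, ?_, ?_⟩
  · -- value at `ρ₀`
    simp only [hP]
    rw [hqρ, hQρ]
    field_simp
  · -- derivative bound
    have hA : HasDerivAt (fun s ↦ deriv riemannZeta (1 - s))
        (-deriv (deriv riemannZeta) (1 - ρ₀)) ρ₀ := by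
      have h1 : (1 - ρ₀) ≠ 1 := fun h ↦ hρ₀0 (by linear_combination -h)
      exact (analyticOn_riemannZeta (1 - ρ₀) h1).deriv.differentiableAt.hasDerivAt.comp_const_sub 1 ρ₀
    have hqD : HasDerivAt q (deriv q ρ₀) ρ₀ := (hqd.differentiableAt (hU1.mem_nhds hρ₀1)).hasDerivAt
    have hQD : HasDerivAt Q (deriv Q ρ₀) ρ₀ := (hQd.differentiableAt (hU0.mem_nhds hρ₀0)).hasDerivAt
    have hPD := (hA.fun_mul hqD).fun_div hQD hQρ0
    rw [show P = fun s ↦ deriv riemannZeta (1 - s) * q s / Q s from rfl, hPD.deriv]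
    -- Cauchy estimates
    have hballs1 : closedBall ρ₀ r ⊆ {z : ℂ | z ≠ 1} := by
      intro z hz h1
      rw [mem_closedBall, dist_eq_norm, h1] at hz
      have := Complex.abs_re_le_norm (1 - ρ₀)
      simp [hre] at this
      linarith [this.trans hz]
    have hballs0 : closedBall ρ₀ r ⊆ {z : ℂ | z ≠ 0} := by
      intro z hz h1
      rw [mem_closedBall, dist_eq_norm, h1] at hz
      have := Complex.abs_re_le_norm (0 - ρ₀)
      simp [hre] at this
      linarith [this.trans (by simpa using hz)]
    have hball2 : closedBall (1 - ρ₀) (2 * r) ⊆ {z : ℂ | z ≠ 1} := by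
      intro z hz h1
      rw [mem_closedBall, dist_eq_norm, h1, show (1 : ℂ) - (1 - ρ₀) = ρ₀ by ring] at hz
      have := Complex.abs_re_le_norm ρ₀
      rw [hre] at this
      have h2 : (1 / 2 : ℝ) ≤ ‖ρ₀‖ := le_trans (by norm_num) this
      linarith
    have hq' : ‖deriv q ρ₀‖ ≤ M / r / r :=
      norm_deriv_dslope_le hr hU1 hballs1 hζd h0 fun z hz ↦ hM z (Or.inl (by
        rw [mem_sphere, dist_eq_norm] at hz; linarith))
    have hQ' : ‖deriv Q ρ₀‖ ≤ M / r / r :=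
      norm_deriv_dslope_le hr hU0 hballs0 hgd hgρ fun z hz ↦ hM (1 - z) (Or.inr (by
        rw [mem_sphere, dist_eq_norm] at hz
        rw [show (1 - z) - (1 - ρ₀) = -(z - ρ₀) by ring, norm_neg]; linarith))
    have hA' : ‖deriv (deriv riemannZeta) (1 - ρ₀)‖ ≤ M / r / r :=
      norm_deriv_deriv_le hr hU1 hball2 hζd fun z hz ↦ hM z (Or.inr (by
        rwa [mem_closedBall, dist_eq_norm] at hz))
    -- the algebra
    set m : ℝ := ‖deriv riemannZeta ρ₀‖ with hm
    have hm0 : 0 < m := norm_pos_iff.2 hd0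
    have hnq : ‖q ρ₀‖ = m := by rw [hqρ]
    have hnQ : ‖Q ρ₀‖ = m := by rw [hQρ, norm_neg, hnorm']
    have hnA : ‖deriv riemannZeta (1 - ρ₀)‖ = m := hnorm'
    set a := deriv (deriv riemannZeta) (1 - ρ₀) with ha
    have hnum : ‖(-a * q ρ₀ + deriv riemannZeta (1 - ρ₀) * deriv q ρ₀) * Q ρ₀ -
        deriv riemannZeta (1 - ρ₀) * q ρ₀ * deriv Q ρ₀‖ ≤
        m ^ 2 * (‖a‖ + ‖deriv q ρ₀‖ + ‖deriv Q ρ₀‖) := by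
      refine (norm_sub_le _ _).trans ?_
      rw [norm_mul, norm_mul, norm_mul, hnQ, hnA, hnq]
      have h1 : ‖-a * q ρ₀ + deriv riemannZeta (1 - ρ₀) * deriv q ρ₀‖ ≤ ‖a‖ * m + m * ‖deriv q ρ₀‖ := by
        refine (norm_add_le _ _).trans ?_
        rw [norm_mul, norm_neg, hnq, norm_mul, hnA]
      nlinarith [norm_nonneg a, norm_nonneg (deriv q ρ₀), norm_nonneg (deriv Q ρ₀)]
    rw [norm_div, norm_pow, hnQ, div_le_iff₀ (by positivity)]
    calc ‖(-a * q ρ₀ + deriv riemannZeta (1 - ρ₀) * deriv q ρ₀) * Q ρ₀ -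
          deriv riemannZeta (1 - ρ₀) * q ρ₀ * deriv Q ρ₀‖
        ≤ m ^ 2 * (‖a‖ + ‖deriv q ρ₀‖ + ‖deriv Q ρ₀‖) := hnum
      _ ≤ m ^ 2 * (M / r / r + M / r / r + M / r / r) := by gcongr
      _ = 3 * (M / r / r) * m ^ 2 := by ring
  · -- the identity off `ρ₀`
    intro s hs hsρ
    obtain ⟨⟨⟨hs0, hQs⟩, hs1⟩, hsb⟩ := hs
    have hζ1 : riemannZeta (1 - s) ≠ 0 := by
      rw [hfacQ s]; exact mul_ne_zero (sub_ne_zero.2 hsρ) hQs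
    have hζ0 : riemannZeta s ≠ 0 := by
      intro hz
      -- `s` would be a non-trivial zero, and then `ζ(1 - s) = ζ(conj s) = 0`
      have hsre : 1 / 4 ≤ s.re := by
        rw [mem_ball, dist_eq_norm] at hsb
        have := Complex.abs_re_le_norm (s - ρ₀)
        rw [sub_re, hre] at this
        rw [abs_le] at this
        linarith [this.1, this.2]
      have hsmem : s ∈ ZetaZeros.riemannZetaNontrivialZeros :=
        ZetaZeros.riemannZetaNontrivialZeros.mem_iff'.2
          ⟨hz, by linarith, re_lt_one_of_riemannZeta_eq_zero hz⟩
      have : riemannZeta (1 - s) = 0 := by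
        rw [one_sub_eq_conj hRH hsmem, riemannZeta_conj, hz, map_zero]
      exact hζ1 this
    refine ⟨hζ1, hζ0, ?_⟩
    simp only [hP]
    rw [hfacQ s, hfacq s]
    have hsρ' : s - ρ₀ ≠ 0 := sub_ne_zero.2 hsρ
    field_simp

end BCF

end Literature.NumberTheory.LFunctions

end
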